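import Mathlib
import Summits.KontsevichZagierPeriods.KontsevichZagierPeriods.Theorems.TorsionLogsGKZLevelThreePairBetaArctan
import Literature.NumberTheory.Transcendental.KZBetaChains
import Literature.Analysis.SpecialFunctions.SelbergIntegralBasic
import HarnessLib

/-!
# `BetaLinearSector` (stmt-KontsevichZagierPeriods-3897), line `fermat-sector-transport` — stub `stub_betaSymm_fold`

Step 1 of Legendre's duplication `B(a,a) = 2^{1-2a}·B(a,1/2)` read INSIDE the Kontsevich–Zagier
calculus of moves (`KZCalculus.lean`), for every rational `a > 0`: the symmetric Beta cell
`r = [(0,1), x^{a-1}(1-x)^{a-1}]` is FOLDED at the algebraic abscissa `1/2`,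

  `[(0,1), x^{a-1}(1-x)^{a-1}] ∼ [(0,1/2), 2·x^{a-1}(1-x)^{a-1}]`.

Proof (three kinds of moves, all between restrictions of `r` and the target `h`, so that no new
representation has to be built):

* rule (1a): split `(0,1) = (0,1/2) ∪ {1/2} ∪ (1/2,1)`; with `W₁ = r|_(0,1/2)`, `W₂ = r|_(1/2,1)`
  one has `[r] − [W₁] − [W₂] ∈ relations` (`of_sub_of_sub_mem_relations_split`: two
  domain-additivity moves, the slice `{1/2}` being null);
* rule (2): the reflection `x ↦ 1 − x` carries `(0,1/2)` onto `(1/2,1)` and FIXES the symmetric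
  integrand, so `[W₁] − [W₂] ∈ relations` (`KZ.of_sub_of_mem_relations_of_boxReflection`);
* rule (1b): on `(0,1/2)`, `2·f = f + f`, so `[h] − [W₁] − [W₁] ∈ relations`.

Hence `[r] − [h] = ([r] − [W₁] − [W₂]) − ([h] − [W₁] − [W₁]) − ([W₁] − [W₂]) ∈ relations`.
The fold is the template `GKZLevelThree.cubicRational_equivalent_half` with the rational integrand
replaced by the (symmetric) Euler–Mellin monomial.

References: M. Kontsevich, D. Zagier, *Periods* (2001), §1.2 rules (1), (2); G. E. Andrews,
R. Askey, R. Roy, *Special Functions* (1999), Thm. 1.5.1 (Legendre's duplication formula).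
-/

noncomputable section

namespace Summit.KontsevichZagierPeriods.FermatIsogeny.BetaLinearSector.Quarters

open Set MeasureTheory
open Literature.NumberTheory.Transcendental Literature.NumberTheory.Transcendental.KZ
open Literature.ModelTheory.ExponentialFields (IsSemialgebraic)
open Summit.KontsevichZagierPeriods.HermiteRigidity.CMTwistQuasiPeriodTransfer
  (isSemialgebraic_setOf_apply_lt_of_isAlgebraic isSemialgebraic_setOf_apply_gt_of_isAlgebraic
    of_sub_of_sub_mem_relations_split)

/-- **Folding the symmetric Beta cell at `1/2`.** For every rational `a > 0`,
`[(0,1), x^{a-1}(1-x)^{a-1}] ∼ [(0,1/2), 2·x^{a-1}(1-x)^{a-1}]` for representations pinned by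
their domains and their integrands on them: split at the algebraic abscissa `1/2` (rule (1a)),
identify the two halves by the reflection `x ↦ 1 − x`, which fixes the symmetric integrand
(rule (2)), and add the two equal integrands on `(0,1/2)` (rule (1b)). This is the first step of
Legendre's duplication formula `B(a,a) = 2^{1-2a} B(a,1/2)` inside the calculus.
[cite: KontsevichZagier2001, §1.2 rules (1), (2)] -/
theorem stub_betaSymm_fold : ∀ a : ℚ, 0 < a → ∀ (r h : KZ.IntegralRep 1),
    r.domain = {x | x 0 ∈ Set.Ioo (0:ℝ) 1} →
    Set.EqOn r.integrand (fun x => (x 0) ^ ((a:ℝ) - 1) * (1 - x 0) ^ ((a:ℝ) - 1)) r.domain →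
    h.domain = {x | 0 < x 0 ∧ x 0 < 1 / 2} →
    Set.EqOn h.integrand (fun x => 2 * ((x 0) ^ ((a:ℝ) - 1) * (1 - x 0) ^ ((a:ℝ) - 1))) h.domain →
    KZ.Equivalent r h := by
  intro a _ r h hrd hri hhd hhi
  have hhalf : IsAlgebraic ℚ ((1:ℝ) / 2) := by
    simpa using isAlgebraic_algebraMap (R := ℚ) (A := ℝ) (1 / 2 : ℚ)
  -- the two halves of `r`
  have hs₁ : IsSemialgebraic ℚ (r.domain ∩ {p : Fin 1 → ℝ | p 0 < 1 / 2}) :=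
    r.isSemialgebraic_domain.inter (isSemialgebraic_setOf_apply_lt_of_isAlgebraic hhalf 0)
  have hs₂ : IsSemialgebraic ℚ (r.domain ∩ {p : Fin 1 → ℝ | 1 / 2 < p 0}) :=
    r.isSemialgebraic_domain.inter (isSemialgebraic_setOf_apply_gt_of_isAlgebraic hhalf 0)
  set W₁ := r.restrict _ hs₁ inter_subset_left with hW₁
  set W₂ := r.restrict _ hs₂ inter_subset_left with hW₂
  -- rule (1a): split at `1/2`
  have hsplit : of r - of W₁ - of W₂ ∈ relations :=
    of_sub_of_sub_mem_relations_split r W₁ W₂ hhalf rfl rfl (fun _ _ => rfl) (fun _ _ => rfl)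
  have hW₁d : W₁.domain = {x : Fin 1 → ℝ | 0 < x 0 ∧ x 0 < 1 / 2} := by
    rw [hW₁, IntegralRep.domain_restrict, hrd]
    ext x
    simp only [mem_inter_iff, mem_setOf_eq, mem_Ioo]
    constructor
    · rintro ⟨⟨h1, -⟩, h2⟩; exact ⟨h1, h2⟩
    · rintro ⟨h1, h2⟩; exact ⟨⟨h1, by linarith⟩, h2⟩
  have hW₂d : W₂.domain = {x : Fin 1 → ℝ | 1 / 2 < x 0 ∧ x 0 < 1} := by
    rw [hW₂, IntegralRep.domain_restrict, hrd]
    ext x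
    simp only [mem_inter_iff, mem_setOf_eq, mem_Ioo]
    constructor
    · rintro ⟨⟨-, h1⟩, h2⟩; exact ⟨h2, h1⟩
    · rintro ⟨h1, h2⟩; exact ⟨⟨by linarith, h2⟩, h1⟩
  -- rule (2): the reflection `x ↦ 1 - x` identifies the lower half with the upper half
  have hrefl : of W₁ - of W₂ ∈ relations := by
    refine of_sub_of_mem_relations_of_boxReflection (0 : Fin 1) ?_ fun x hx => ?_
    · rw [hW₁d, hW₂d]
      ext x
      simp only [mem_setOf_eq, mem_preimage, boxReflection_apply_self]
      constructor <;> rintro ⟨h1, h2⟩ <;> constructor <;> linarith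
    · have hx' : 0 < x 0 ∧ x 0 < 1 / 2 := by rw [hW₁d] at hx; exact hx
      have hmem : x ∈ r.domain := by rw [hrd]; exact ⟨hx'.1, by linarith [hx'.2]⟩
      have hmem' : boxReflection (0 : Fin 1) x ∈ r.domain := by
        rw [hrd]
        show boxReflection 0 x 0 ∈ Ioo (0:ℝ) 1
        rw [boxReflection_apply_self]
        exact ⟨by linarith [hx'.2], by linarith [hx'.1]⟩
      rw [hW₁, hW₂, IntegralRep.integrand_restrict, IntegralRep.integrand_restrict, hri hmem,
        hri hmem']
      simp only [boxReflection_apply_self, sub_sub_cancel]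
      ring
  -- rule (1b): `2·f = f + f` on `(0,1/2)`
  have hadd : of h - of W₁ - of W₁ ∈ relations := by
    refine integrandAddRel_subset_relations ⟨1, h, W₁, W₁, by rw [hW₁d, hhd], by rw [hW₁d, hhd],
      fun x hx => ?_, rfl⟩
    have hx' : 0 < x 0 ∧ x 0 < 1 / 2 := by rw [hhd] at hx; exact hx
    have hmem : x ∈ r.domain := by rw [hrd]; exact ⟨hx'.1, by linarith [hx'.2]⟩
    rw [hhi hx, Pi.add_apply, hW₁, IntegralRep.integrand_restrict, hri hmem]
    dsimp only
    ring
  have : of r - of h = (of r - of W₁ - of W₂) - (of h - of W₁ - of W₁) - (of W₁ - of W₂) := by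
    abel
  show of r - of h ∈ relations
  rw [this]
  exact relations.sub_mem (relations.sub_mem hsplit hadd) hrefl

end Summit.KontsevichZagierPeriods.FermatIsogeny.BetaLinearSector.Quarters
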